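import Summits.QuantumAdvantage.QuantumAdvantage.Theorems.CubicForrelationNearExactIsExactTwelveLevelSixRigidPack224

/-!
# Crux `CubicForrelation.NearExactIsExact` (stmt-QuantumAdvantage-14043) — n = 12, level ≥ 6 in the window `(928/1024, 932/1024)`: packaging the
  RIGID off-flat configurations at every off-flat energy `E < 256` (`≥ 48` points of cost `≥ 4`, less than `64` to spare — a weighted count of
  the exceptional points)

Certificate seat `b2b-cforr-cert` (gen 20).  HONEST FRAMING: elementary bookkeeping (standard axioms) for the level-`≥ 6` × level-`≥ 6` branch of
the window `(928/1024, 932/1024)` at `n = 12` (total budget `Σ e² < 768`, hence off-flat energy `< 768 − 512 = 256`); a finite-slice lemma, NOT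
summit progress, and NO new value of `θ₁₂` is claimed here.  (`tw20_rigid_pack_lt240`, landed earlier the same day, is the special case
`E < 240` with the coarser conclusion `#Ω ≤ 59`, at most three exceptional points.)

`tw20_rigid_pack_lt256` is `tw18_rigid_pack224` (gen 18) with the energy bound replaced by a parameter `E < 256` and a WEIGHTED conclusion: if
`48` or more points `U` off `Z`, each with `e² = 4` or `e² ≥ 16`, lie in three given cosets, every other point off `Z` has `e = 0` or `e² ≥ 16`,
every point off `Z` outside the three cosets with `8 ∤ e` comes with `8` points off `Z` outside the cosets of cost `≥ 16` each (round 2 of the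
off-flat analysis), and the off-flat energy is `≤ E < 256`, then the set `Ω = {y ∉ Z : 8 ∤ e(y)}` lies in the three cosets (a far point would
cost `128 > E − 192`), `4·#Ω + 12·#{ω ∈ Ω : e(ω)² ≠ 4} ≤ E` (every point of `Ω` costs `≥ 4`, an exceptional one `≥ 16`; in particular
`#Ω + #{exceptional} ≤ 63`, the weight budget of the few-hit transversal lemma), and the energy is `≥ 192`.
-/

set_option linter.dupNamespace false -- D-0017: single-problem summit ⇒ `QuantumAdvantage.QuantumAdvantage` by design

noncomputable section

namespace Summit.QuantumAdvantage.QuantumAdvantage.Theorems.CubicForrelation.NearExactIsExact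

open Finset

/-- **Rigid packaging at off-flat energy `E < 256`** (weighted count of the exceptional points).  See the module docstring. [this work] -/
theorem tw20_rigid_pack_lt256 {α : Type*} [DecidableEq α] [Fintype α] (E : ℤ) (hE : E < 256) (e : α → ℤ) (Z U C₁ C₂ C₃ : Finset α)
    (hUZ : ∀ x ∈ U, x ∉ Z) (hU4 : ∀ x ∈ U, e x ^ 2 = 4 ∨ 16 ≤ e x ^ 2) (hU48 : 48 ≤ #U) (hUC : ∀ x ∈ U, x ∈ C₁ ∨ x ∈ C₂ ∨ x ∈ C₃)
    (hout : ∀ x, x ∉ Z → x ∉ U → e x = 0 ∨ 16 ≤ e x ^ 2)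
    (hfar : ∀ x, x ∉ Z → ¬ (x ∈ C₁ ∨ x ∈ C₂ ∨ x ∈ C₃) → ¬ (8 : ℤ) ∣ e x →
      ∃ T : Finset α, 8 ≤ #T ∧ (∀ y ∈ T, y ∉ Z ∧ ¬ (y ∈ C₁ ∨ y ∈ C₂ ∨ y ∈ C₃)) ∧ ∀ y ∈ T, 16 ≤ e y ^ 2)
    (hoff_le : ∑ x ∈ univ.filter (fun x => x ∉ Z), e x ^ 2 ≤ E) :
    (∀ ω ∈ univ.filter (fun ω => ω ∉ Z ∧ ¬ (8 : ℤ) ∣ e ω), ω ∈ C₁ ∨ ω ∈ C₂ ∨ ω ∈ C₃) ∧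
    4 * (#(univ.filter (fun ω => ω ∉ Z ∧ ¬ (8 : ℤ) ∣ e ω)) : ℤ) +
      12 * #((univ.filter (fun ω => ω ∉ Z ∧ ¬ (8 : ℤ) ∣ e ω)).filter fun ω => e ω ^ 2 ≠ 4) ≤ E ∧
    192 ≤ ∑ x ∈ univ.filter (fun x => x ∉ Z), e x ^ 2 := by
  classical
  have hUsub : U ⊆ univ.filter (fun x => x ∉ Z) := fun x hx => mem_filter.2 ⟨mem_univ _, hUZ x hx⟩
  have hU4' : ∀ x ∈ U, 4 ≤ e x ^ 2 := fun x hx => by rcases hU4 x hx with h | h <;> linarith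
  have hUsum_ge : 4 * (#U : ℤ) ≤ ∑ x ∈ U, e x ^ 2 := by
    have h := sum_le_sum hU4'
    rw [sum_const, nsmul_eq_mul] at h
    linarith
  have hsplit := sum_filter_add_sum_filter_not (univ.filter fun x => x ∉ Z) (fun x => x ∈ U) (fun x => e x ^ 2)
  have e1 : (univ.filter fun x : α => x ∉ Z).filter (fun x => x ∈ U) = U := by
    ext y; simp only [mem_filter, mem_univ, true_and]; exact ⟨fun h => h.2, fun h => ⟨hUZ y h, h⟩⟩
  rw [e1] at hsplit
  set Rest := (univ.filter fun x : α => x ∉ Z).filter (fun x => x ∉ U) with hRest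
  have hrest_nn : 0 ≤ ∑ x ∈ Rest, e x ^ 2 := sum_nonneg fun y _ => sq_nonneg (e y)
  have hU48' : (48 : ℤ) ≤ #U := by exact_mod_cast hU48
  have hrest64 : ∑ x ∈ Rest, e x ^ 2 < 64 := by linarith
  -- far points have `8 ∣ e`
  have hfar8 : ∀ x, x ∉ Z → ¬ (x ∈ C₁ ∨ x ∈ C₂ ∨ x ∈ C₃) → (8 : ℤ) ∣ e x := by
    intro x hxZ hxC
    by_contra h8
    obtain ⟨T, hT8, hTfar, hT16⟩ := hfar x hxZ hxC h8
    have hTsub : T ⊆ Rest := fun y hy =>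
      mem_filter.2 ⟨mem_filter.2 ⟨mem_univ _, (hTfar y hy).1⟩, fun hyU => (hTfar y hy).2 (hUC y hyU)⟩
    have h1 : ∑ y ∈ T, (16 : ℤ) ≤ ∑ y ∈ T, e y ^ 2 := sum_le_sum hT16
    rw [sum_const, nsmul_eq_mul] at h1
    have h2 := sum_le_sum_of_subset_of_nonneg hTsub (f := fun y => e y ^ 2) fun y _ _ => sq_nonneg _
    have hT8' : (8 : ℤ) ≤ #T := by exact_mod_cast hT8
    linarith
  have hΩC : ∀ ω ∈ univ.filter (fun ω => ω ∉ Z ∧ ¬ (8 : ℤ) ∣ e ω), ω ∈ C₁ ∨ ω ∈ C₂ ∨ ω ∈ C₃ := by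
    intro ω hω
    obtain ⟨hωZ, hω8⟩ := (mem_filter.1 hω).2
    by_contra hC
    exact hω8 (hfar8 ω hωZ hC)
  -- the weighted count: on `Ω` the cost `e²` is `≥ 4`, and `≥ 16 = 4 + 12` at an exceptional point (`e² ≠ 4`, `e ≠ 0`)
  set Ω := univ.filter (fun ω => ω ∉ Z ∧ ¬ (8 : ℤ) ∣ e ω) with hΩdef
  have hne0 : ∀ ω ∈ Ω, e ω ≠ 0 := by
    intro ω hω h0
    exact (mem_filter.1 hω).2.2 (by rw [h0]; exact dvd_zero _)
  have hΩval : ∀ ω ∈ Ω, e ω ^ 2 = 4 ∨ 16 ≤ e ω ^ 2 := by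
    intro ω hω
    have hωZ := (mem_filter.1 hω).2.1
    by_cases hωU : ω ∈ U
    · exact hU4 ω hωU
    · rcases hout ω hωZ hωU with h0 | h16
      · exact absurd h0 (hne0 ω hω)
      · exact Or.inr h16
  set wt : α → ℤ := fun ω => if e ω ^ 2 ≠ 4 then 16 else 4 with hwt
  have hwt_le : ∀ ω ∈ Ω, wt ω ≤ e ω ^ 2 := by
    intro ω hω
    simp only [wt]
    by_cases h4 : e ω ^ 2 ≠ 4
    · rw [if_pos h4]
      rcases hΩval ω hω with h | h
      · exact absurd h h4
      · exact h
    · rw [if_neg h4]; push Not at h4; rw [h4]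
  have hΩsub : Ω ⊆ univ.filter (fun x => x ∉ Z) := fun ω hω => mem_filter.2 ⟨mem_univ _, (mem_filter.1 hω).2.1⟩
  have hwsum : ∑ ω ∈ Ω, wt ω = 4 * (#Ω : ℤ) + 12 * #(Ω.filter fun ω => e ω ^ 2 ≠ 4) := by
    have h1 : ∑ ω ∈ Ω, wt ω = ∑ ω ∈ Ω, ((4 : ℤ) + (if e ω ^ 2 ≠ 4 then 12 else 0)) := by
      refine sum_congr rfl fun ω _ => ?_
      simp only [wt]
      split_ifs <;> norm_num
    rw [h1, sum_add_distrib, sum_const, nsmul_eq_mul, ← sum_filter, sum_const, nsmul_eq_mul]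
    ring
  refine ⟨hΩC, ?_, ?_⟩
  · have h1 : ∑ ω ∈ Ω, wt ω ≤ ∑ ω ∈ Ω, e ω ^ 2 := sum_le_sum hwt_le
    have h2 := sum_le_sum_of_subset_of_nonneg hΩsub (f := fun y => e y ^ 2) fun y _ _ => sq_nonneg _
    rw [hwsum] at h1
    linarith
  · have hUle' : ∑ x ∈ U, e x ^ 2 ≤ ∑ x ∈ univ.filter (fun x => x ∉ Z), e x ^ 2 :=
      sum_le_sum_of_subset_of_nonneg hUsub fun x _ _ => sq_nonneg _
    linarith

end Summit.QuantumAdvantage.QuantumAdvantage.Theorems.CubicForrelation.NearExactIsExact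

end
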